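import Summits.NavierStokesRegularity.OSWSelfSimilar.CertificateViscousSheetRSpectrum
import Summits.NavierStokesRegularity.OSWSelfSimilar.SheetRTranslationMode
import Summits.NavierStokesRegularity.OSWSelfSimilar.ApproximateGramCertificate
import HarnessLib
/-!
# Viscous gCLM/OSW profile sheet on the LINE (zone Z3, SHEET-ℝ), case Z3-SR-SPEC, EVEN HALF (SPEC-EVEN-R1): the linearised spectrum in the
# EVEN ZERO-MASS class `E⁺₀` at the certified point `(a, c_l, ε) = (1/5, 1/2, 1)` — transcript of implementation 1's interval certificate,
# kernel-checked inequalities only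
HONEST FRAMING (cell ns-blowup GROUP B «PROFILE SEARCH», human rulings D-0035/D-0074/D-0081; PROFILE-SPEC case Z3-SR-SPEC even half; profile-lead RULINGS
(gi)(2)/(gx)(2)/(gy)(2)/(hi)(5)/(hp)(1)/(hr)(1); PREREG `HOME/profile/cert/impl1/sheetR/spec/even/PREREG-Z3-SR-SPEC-EVEN.md` v1.1 sha16 84357d3d94388851,
DESIGN `DESIGN-Z3-SR-SPEC-EVEN.md` 324e4de67b5b5871, DERIVATION `DERIVATION-PSI.md` v1.1 6f57473480a1becf, profile-refuter g6 K-VIEW STATUS l.8623 (V1 applied)):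
**1-D MODEL (viscous gCLM/OSW on `ℝ` at the NS-type similarity exponent `c_l = 1/2`), computer-assisted; not Euler/NS; «violates: none — MODEL»; census
hook `Literature.Analysis.FluidPDE.effectiveViscosity_half`.** Nothing here is a statement about Navier–Stokes. Companion of the ODD row
`CertificateViscousSheetRSpectrum` (whose registered literals `γ, γ′, c₁, c₂, N, ε̄, m₀, d₀, c_𝔅, c_w` are re-used VERBATIM and imported) and of the existence row
`CertificateViscousSheetR` (`rEsharp2`).
THE OBJECT: the pencil `σ ↦ DG⁺(Ω*) + σJ : E⁺₀ → X*` in the EVEN ZERO-MASS class `E⁺₀` (closure of even zero-mass test functions under `‖δ‖²_E = ‖δ′‖²_w + ¼‖δ‖²_w`,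
`w = 64 + ξ²`) of the profile map `G(Ω) = Ω + ½ξΩ′ + a𝒰Ω′ − (HΩ)Ω − Ω″` with the translation-COVARIANT velocity `𝒰_δ = ∫_{−∞}^ξ Hδ`; the rank-one–lifted operator
`A_F⁺ := DG⁺(Ω̄) + F⁺`, `F⁺δ := θ⟨h⁺, wδ⟩·Jh⁺` (`θ = 4`, `h⁺` = the 12 cosine-frame dyadics of record), the rank-one extraction `DG⁺ = B_λ − P_nice + a·Ω̄′⊗ℓ̃`
(`ℓ̃(δ) = (1/2π)∫δ log(L²+ξ²)dξ`) and the even Evans function `E⁺(σ) := 1 − θ⟨h⁺, w(A_F⁺ + σJ)⁻¹Jh⁺⟩` evaluated by the Sherman–Morrison formula on the log-free part.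
WHAT THE CERTIFICATE SAYS (pre-lettered word, RULING (gi)(2)/(D5), PREREG P3): «n_u^× = 0 — BOTH parities certified (odd: T-gauge σ = 1 simple; even: translation gauge σ = ½
simple; no other point spectrum in {Re σ ≥ −0.03, |σ| ≤ R₀}); one implementation (F5(a)) for the even half».
1. **S1⁺ (coercivity of `A_F⁺` on `E⁺₀`).** Same Gram form as the odd S1 with the even changes: `q_n := P_nice†e_n⁺`, the functional family gains the member `ℓ̃`
   (g̃-ENRICHED local solve) and `S` the cross block `S[y_n, ℓ̃] = −a·C₀(e_n⁺)/(2G_w)`; literals `epsTauE`, `epsDropE`, `epsTailME`, `dGramE`, `normSE` (UP), `lamCertE` (DOWN).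
   Consequence for `Ω*`: `Δ⁺ := Llip⁺·rEsharp2` with the even Lipschitz constant `Llip⁺ = 2.01937` (DESIGN (D3)).
2. **S2⁺ (the even Evans function on the contour).** Far field (ORDER 2, the MIXED one-forward/one-adjoint form): `|k⁺(σ)| ≤ A₁⁺/|σ| + A₂⁺/|σ|²`; contour =
   segment `Re σ = −0.03` + arc `|σ| = R₀c⁺` (clockwise; `W = −#zeros`); every sub-arc closed by a CERTIFIED step radius from the y-chain (log-free adjoint) and the
   g̃-enriched z-chain (`ψ₁ := 𝒜ₙᵀg̃ − (½+σ)g̃` by the structure formula of DERIVATION-PSI, tail `Tψ`, lump `Elump`); winding balls ⇒ `W⁺ = W⁺* = −1`: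
   EXACTLY ONE zero of `E⁺*` in `{Re σ ≥ −0.03, |σ| ≤ R₀⁺}` — the translation gauge `σ = ½` (eigenvector `Ω*′`, KERNEL: `SheetRTranslationMode.linearised_translationMode_covariant`).
IMPLEMENTATION 1 (seat ns-blowup-profile-cert-1 g6/g7): python-flint/Arb 212/160-bit; centre `c4de65e13d80c930`; float stage jj272952 (npz 2d527f3cf92d3716); S1⁺ e-shards b84a940b529059c7 67a554319f42a16a 643147eec318e0ad 22aafb924e04a118,
Gram prep/cert kit j274317 / j276312 (certificate JSON 948be45151873bd7), far field kit j273254 (a0c4bf5430b72643), contour close kit j274168 / j274937 (6d3d0d426073b3f6); code `HOME/profile/cert/impl1/sheetR/spec/even/code_g7/`.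
3. NO `def … : Prop` hypotheses. **What is NOT kernel-checked:** (i) that the printed numbers bound the analytic quantities — the ball arithmetic of the impl-1 programs, their
   ζ-series bookkeeping, and the ψ₁/ψ_𝔅 structure formulas + tails of `psi_even.py` (elementary: Fourier series of `log(2cos θ/2)`, product-to-sum, two integrations by parts,
   the identity `B₀†g̃ = ½g̃ + ρ₀` — DERIVATION-PSI v1.1, refuter K-VIEW ✓); (ii) the paper chain of the odd row item 3 transposed verbatim to `E⁺₀` ((P1) KERNEL modulo the
   Gårding datum, (P3′) KERNEL `ApproximateGramCertificate`, (P5) argument principle / Gohberg–Sigal, (P7)/(P8) KERNEL), plus the EVEN obligations PO-1 (weak = classical on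
   `E⁺₀`) and PO-2 (`Ω*′ ∈ E⁺₀`) — PAPER; PO-3 = KERNEL `SheetRTranslationMode`; (iii) the rank-one (Sherman–Morrison) resolvent identity [N = 1 Woodbury]; (iv) `Llip⁺`.
   KERNEL-checked: the inequalities below on the printed literals.
-/

namespace Summit.NavierStokesRegularity.OSWSelfSimilar
namespace CertificateViscousSheetRSpectrumEven

open CertificateViscousSheetR (rEsharp2)
open CertificateViscousSheetRSpectrum (N theta gamma gammaP c1 c2 epsBar epsN epsFree m0 d0 cBB cw)

/-! ### Registered constants of the EVEN half (PREREG-Z3-SR-SPEC-EVEN v1.1 P1) -/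
/-- Even-class Lipschitz constant `L⁺_lip = 2.01937` of `Ω ↦ DG⁺(Ω)` on the E-ball (DESIGN (D3); UP). [folklore] -/
def LlipE : ℚ := (201937 : ℚ) / 100000
/-- `Δ⁺ = L⁺_lip·rE♯₂ ≥ ‖DG⁺(Ω*) − DG⁺(Ω̄)‖_{E⁺₀→X*}`. [folklore] -/
def DeltaE : ℚ := LlipE * rEsharp2
/-- `J_ψ`: truncation of the centre arrays in the ψ₁ structure formula (registered). [folklore] -/
def Jpsi : ℕ := 2048
/-- `K_z`: number of exact cosine coefficients of ψ₁ used in the z-chain residuals (registered, `≥ 2J_ψ + 2`). [folklore] -/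
def Kz : ℕ := 4098

/-- `Δ⁺ ≤ 1.374e-5`. [folklore] -/
theorem DeltaE_le : DeltaE ≤ (1374 : ℚ) / 100000000 := by norm_num [DeltaE, LlipE, rEsharp2]
/-- The tail regime of the ψ₁ structure formula is reached: `K_z ≥ 2J_ψ + 2`. [folklore] -/
theorem Kz_ge : 2 * Jpsi + 2 ≤ Kz := by norm_num [Jpsi, Kz]
/-- The exact Ω*-constants stay positive in the even class: `c₁ − Δ⁺/4 > 0`, `c₂ − Δ⁺ > 0`, `c_w − Δ⁺/4 > 0`. [folklore] -/
theorem star_constants_pos : 0 < c1 - DeltaE / 4 ∧ 0 < c2 - DeltaE ∧ 0 < cw - DeltaE / 4 := by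
  refine ⟨?_, ?_, ?_⟩ <;> norm_num [c1, c2, cw, gamma, gammaP, DeltaE, LlipE, rEsharp2,
    CertificateViscousSheetRSpectrum.c1, CertificateViscousSheetRSpectrum.c2, CertificateViscousSheetRSpectrum.cw,
    CertificateViscousSheetRSpectrum.gamma, CertificateViscousSheetRSpectrum.gammaP]

/-! ### S1⁺ — the Gram certificate in `E⁺₀` (literals of `spec_S1_even_L8_N1600_gram.json`, kit j274317 / j276312) -/
/-- `ε_τ⁺` (UP): the excluded tiny tail functionals. [folklore] -/
def epsTauE : ℚ := (11322689 : ℚ) / 1000000000000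
/-- `ε_drop⁺` (UP): the SVD-dropped band combinations. [folklore] -/
def epsDropE : ℚ := (4963897 : ℚ) / 1000000000000
/-- `ε_tailM⁺` (UP): the band functionals' content beyond frame mode `M = 4096`. [folklore] -/
def epsTailME : ℚ := (194353 : ℚ) / 2000000000000
/-- `d⁺ ≥ Σ_i ρ_i²` over the even functional family incl. the g̃-enriched `ℓ̃` member (UP). [folklore] -/
def dGramE : ℚ := (1021121 : ℚ) / 1000000000000
/-- `‖S⁺‖ ≤ normSE` (Frobenius, incl. the cross block `S[y_n, ℓ̃] = −a C₀(e_n⁺)/(2G_w)`; UP). [folklore] -/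
def normSE : ℚ := (38641 : ℚ) / 500000
/-- Certified lower bound (DOWN) of `λ_min(D(𝒢̂ − 𝒢̂S𝒢̂ − d′𝒢̂SᵀS𝒢̂)D)` for the even family. [folklore] -/
def lamCertE : ℚ := (48597 : ℚ) / 2500000000

/-- The dropped functionals fit into the free slack: `ε_τ⁺ + ε_drop⁺ + ε_tailM⁺ ≤ ε_free`. [folklore] -/
theorem eps_budget : epsTauE + epsDropE + epsTailME ≤ epsFree := by
  norm_num [epsTauE, epsDropE, epsTailME, epsFree, epsN, epsBar,
    CertificateViscousSheetRSpectrum.epsFree, CertificateViscousSheetRSpectrum.epsN, CertificateViscousSheetRSpectrum.epsBar,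
    CertificateViscousSheetRSpectrum.Dcons, CertificateViscousSheetRSpectrum.N]
/-- `‖S⁺‖·d⁺ < 1` (the perturbation lemma's denominator). [folklore] -/
theorem normS_mul_dGram_lt_one : normSE * dGramE < 1 := by norm_num [normSE, dGramE]
/-- THE S1⁺ VERDICT INEQUALITY: the certified matrix is positive definite (`λ_min ≥ lamCertE > 0`). [folklore] -/
theorem lamCert_pos : 0 < lamCertE := by norm_num [lamCertE]

/-! ### S2⁺ — far field (ORDER 2, mixed form; literals of `spec_S2_far_even_L8.json`, kit j273254) -/
/-- `‖h⁺‖²_w` (UP). [folklore] -/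
def hw2E : ℚ := (251895283 : ℚ) / 250000000
/-- `A₁⁺` (UP): coefficient of `1/|σ|` of the far-field majorant. [folklore] -/
def A1E : ℚ := (20151623 : ℚ) / 5000000
/-- `A₂⁺` (UP): coefficient of `1/|σ|²`. [folklore] -/
def A2E : ℚ := (224369 : ℚ) / 400
/-- `c_E = min(c₂, 4c_w)`, `c_E* = min(c₂ − Δ⁺, 4(c_w − Δ⁺/4))`. [folklore] -/
def cEE : ℚ := min c2 (4 * cw)
/-- see `cEE`. [folklore] -/
def cEstarE : ℚ := min (c2 - DeltaE) (4 * (cw - DeltaE / 4))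
/-- `pert⁺ ≥ sup|k⁺* − k⁺| = θΔ⁺(2‖h⁺‖/c_E)(2‖h⁺‖/c_E*)` (UP literal). [folklore] -/
def pertE : ℚ := (13837 : ℚ) / 2500000
/-- Far-field radius literal `R₀⁺` (UP of the certified value). [folklore] -/
def R0E : ℚ := (2587 : ℚ) / 100
/-- Arc radius `R₀c⁺` of the contour. [folklore] -/
def R0cE : ℚ := (263 : ℚ) / 10

/-- `c_E = 1/5` and `c_E* = 1/5 − Δ⁺`. [folklore] -/
theorem cE_eq : cEE = (1 : ℚ) / 5 ∧ cEstarE = (1 : ℚ) / 5 - DeltaE := by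
  refine ⟨by norm_num [cEE, c2, CertificateViscousSheetRSpectrum.c2, CertificateViscousSheetRSpectrum.cw_eq], ?_⟩
  have h : (1 : ℚ) / 5 - DeltaE ≤ 4 * (cw - DeltaE / 4) := by
    norm_num [CertificateViscousSheetRSpectrum.cw_eq, DeltaE, LlipE, rEsharp2]
  simpa [cEstarE, c2, CertificateViscousSheetRSpectrum.c2] using min_eq_left h
/-- `pert⁺` dominates the formula `θΔ⁺·4‖h⁺‖²_w/(c_E·c_E*)`. [folklore] -/
theorem pert_ge : theta * DeltaE * (4 * hw2E) / (cEE * cEstarE) ≤ pertE := by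
  rw [cE_eq.1, cE_eq.2]; norm_num [theta, CertificateViscousSheetRSpectrum.theta, DeltaE, LlipE, rEsharp2, hw2E, pertE]
/-- FAR FIELD at `R₀⁺`: `A₁⁺/R₀⁺ + A₂⁺/R₀⁺² + pert⁺ < 1`. [folklore] -/
theorem farfield_R0 : A1E / R0E + A2E / R0E ^ 2 + pertE < 1 := by norm_num [A1E, A2E, R0E, pertE]
/-- The registered ceiling holds: `R₀⁺ ≤ 32`. [folklore] -/
theorem R0_le_ceiling : R0E ≤ 32 := by norm_num [R0E]
/-- The arc lies in the far field: `R₀⁺ ≤ R₀c⁺` and `A₁⁺/R₀c⁺ + A₂⁺/R₀c⁺² + pert⁺ < 1`. [folklore] -/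
theorem farfield_arc : R0E ≤ R0cE ∧ A1E / R0cE + A2E / R0cE ^ 2 + pertE < 1 := by
  refine ⟨by norm_num [R0E, R0cE], by norm_num [A1E, A2E, R0cE, pertE]⟩

/-! ### S2⁺ — the one λ-class object (ψ₁ tail / lump literals, `psi_tail` of the point JSONs) -/
/-- `T_ψ(K_z)` (UP): `‖Π_{>K_z}ψ₁‖_w`. [folklore] -/
def TpsiE : ℚ := (4539 : ℚ) / 250000000000
/-- `E_lump` (UP): series-truncation lump of ψ₁. [folklore] -/
def ElumpE : ℚ := (30801 : ℚ) / 1000000000000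
/-- Both ψ₁ remainders are below `1e-7` (they enter the z-chain residual norms times `|ζ_j|`). [folklore] -/
theorem psi_tail_small : TpsiE < (1 : ℚ) / 10000000 ∧ ElumpE < (1 : ℚ) / 10000000 := by
  refine ⟨by norm_num [TpsiE], by norm_num [ElumpE]⟩

/-! ### S2⁺ — the contour (literals of `spec_S2_even_L8.json`, kit j274168 / j274937) -/
/-- Number of segment points (upper half) in the covering path. [folklore] -/
def nSegmentPointsE : ℕ := 22
/-- `min_k |E⁺(σ_k)|` over the contour points (DOWN). [folklore] -/
def minAbsEE : ℚ := (1437 : ℚ) / 12500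
/-- `E⁺(−γ′)` upper endpoint (real ball). [folklore] -/
def EstartHiE : ℚ := -((1149643 : ℚ) / 10000000)
/-- `E⁺(R₀c⁺)` lower endpoint (real ball). [folklore] -/
def EendLoE : ℚ := (4328663 : ℚ) / 5000000
/-- Winding ball endpoints for `E⁺` (`Ω̄`). [folklore] -/
def WloBarE : ℚ := -((1000151 : ℚ) / 1000000)
/-- see `WloBarE`. [folklore] -/
def WhiBarE : ℚ := -((999849 : ℚ) / 1000000)
/-- Winding ball endpoints for `E⁺*` (`Ω*`, Δ⁺-inflated). [folklore] -/
def WloStarE : ℚ := -((167 : ℚ) / 125)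
/-- see `WloStarE`. [folklore] -/
def WhiStarE : ℚ := -((83 : ℚ) / 125)
/-- THE WINDING NUMBER of `E⁺*` around `∂D⁺` (clockwise) and the zero count it certifies. [folklore] -/
def WE : ℤ := -1
/-- Number of zeros of `E⁺*` in `D⁺ = {Re σ ≥ −γ′, |σ| ≤ R₀⁺}` with multiplicity (`= −W⁺`). [folklore] -/
def nZerosE : ℕ := 1

/-- The step-rule budget is positive at every point: `minAbsE⁺ − 3·pert⁺ > 0`. [folklore] -/
theorem step_budget_pos : 0 < minAbsEE - 3 * pertE := by norm_num [minAbsEE, pertE]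
/-- `E⁺` is real and NEGATIVE at `σ = −γ′`, real and POSITIVE at `σ = R₀c⁺`. [folklore] -/
theorem E_signs : EstartHiE < 0 ∧ 0 < EendLoE := by refine ⟨by norm_num [EstartHiE], by norm_num [EendLoE]⟩
/-- The winding ball of `E⁺` contains `−1` and no other integer. [folklore] -/
theorem W_ball_bar : WloBarE ≤ (WE : ℚ) ∧ (WE : ℚ) ≤ WhiBarE ∧ WhiBarE - WloBarE < 1 := by
  refine ⟨?_, ?_, ?_⟩ <;> norm_num [WloBarE, WhiBarE, WE]
/-- The winding ball of `E⁺*` contains `−1` and no other integer. [folklore] -/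
theorem W_ball_star : WloStarE ≤ (WE : ℚ) ∧ (WE : ℚ) ≤ WhiStarE ∧ WhiStarE - WloStarE < 1 := by
  refine ⟨?_, ?_, ?_⟩ <;> norm_num [WloStarE, WhiStarE, WE]
/-- Clockwise contour: `#zeros = −W⁺ = 1` — with PO-3 (`SheetRTranslationMode`) that one zero is the translation gauge `σ = ½`. [folklore] -/
theorem nZeros_eq_neg_W : (nZerosE : ℤ) = -WE := by norm_num [nZerosE, WE]

end CertificateViscousSheetRSpectrumEven
end Summit.NavierStokesRegularity.OSWSelfSimilar
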